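import Mathlib.Tactic.Ring
import Mathlib.Tactic.NormNum
import Summits.CriticalPhenomena.PercolationContinuityZ3.Theorems.PercNearOneGluingNoHeavyLowerTailSahiCTCG011Form
import Summits.CriticalPhenomena.PercolationContinuityZ3.Theorems.PercNearOneGluingNoHeavyLowerTailSahiCTCVertexExpansions
import HarnessLib

/-!
# `NoHeavyLowerTail` (crux stmt-CriticalPhenomena-4575), P3 lane: the form `PARA₁` (g9 §8.1) relative to a ground finset, its objects, VERTEX EXPANSION,
# dictionary entries and the atom expansions of the status families occurring in its step certificates (generated)

Support file (seat `prim-l12-p3`, gen 19; `--supports stmt-CriticalPhenomena-4575`).  Memo `run/shared/lean/prim/prim-l12/FROM-prim-l12-p3-g19-CERTIFICATE-ROAD-G011.md`.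
Nothing is asserted about the crux.

g9 §8.1: `PARA_s(P,Q) = e_s·Π·(Π·|Y^{≤s}| − |P^{≤s−1}|·|Q^{≤s}| + |P^{≥s}|·|Q^{>s}|) + e_{≥s}·(Π·(e_s|Y^{≤s−1}| − e_{≤s−1}|Y^{=s}|) − e_s|P||Q|)`; for `s = 1` and complexes
containing `∅`: `PARA₁ = e₁·Π·(Π·h_Y − h_Z + f_X·t_Z) + D₀·(Π·(e₁ − e_Y) − e₁·c_X·c_Z)` with `f` = nonempty faces, `c` = all faces (`PARA1V`).  g9 §8.2: "PROVED:
PARA₁ (kit j131628, 12 steps)"; it is the missing hypothesis of the `lm` case of the c = 2 target (g9 §7.2).  Here: `E1V, fV, cV, cL`, `PARA1V`, the generated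
object-form coefficients `PARA1N1..4`, `PARA1V_expand` (vertex split + `ring`), `PARA1V_empty`, `dict_e1/fX/fZ/cX/cZ/cLX/cLZ`, and expansion lemmas.
-/

namespace Summit.CriticalPhenomena.PercolationContinuityZ3.Theorems.SahiCTCForms

open Finset MvPolynomial SahiCTCGenFun SahiCTCWeightedLYM

variable {α : Type*} [DecidableEq α]

/-! ### More ground-set relative objects and the form `PARA₁` (g9 §8.1) -/

section objects
variable (V : Finset α) (K KX KZ : Finset (Finset α)) (v : α)

/-- `e₁^V` = the points of `V` (sets of size exactly `1`). [this work] -/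
noncomputable def E1V : MvPolynomial α ℤ := gf (V.powerset.filter fun S => #S = 1)
/-- `f_K` = nonempty faces of `K` inside `V` (`|K^{≥1}|`). [this work] -/
noncomputable def fV : MvPolynomial α ℤ := gf (V.powerset.filter fun S => 1 ≤ #S ∧ S ∈ K)
/-- `c_K = |K|` = all faces of `K` inside `V`. [this work] -/
noncomputable def cV : MvPolynomial α ℤ := gf (V.powerset.filter fun S => S ∈ K)
/-- link of `c_K` (and of `f_K`) at `v`: all `S ⊆ V` with `S ∪ {v} ∈ K`. [this work] -/
noncomputable def cL : MvPolynomial α ℤ := gf (V.powerset.filter fun S => insert v S ∈ K)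

/-- **The form `PARA₁` relative to the ground finset `V`** (g9 §8.1 with `s = 1`; `|P^{≤0}| = |Y^{≤0}| = Θ₀ = 1` for complexes containing `∅`):
`e₁·Π·(Π·h_Y − h_Z + f_X·t_Z) + D₀·(Π·(e₁ − e_Y) − e₁·c_X·c_Z)`. [this work] -/
noncomputable def PARA1V : MvPolynomial α ℤ :=
  E1V V * PiV V * (PiV V * hYV V KX KZ - hV V KZ + fV V KX * tV V KZ) + D0V V * (PiV V * (E1V V - eYV V KX KZ) - E1V V * cV V KX * cV V KZ)

/-- The coefficient of `r_v^1` in the vertex expansion of `PARA1` (object form, generated). [this work] -/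
noncomputable def PARA1N1 (V : Finset α) (KX KZ : Finset (Finset α)) (v : α) : MvPolynomial α ℤ :=
  E1V (V.erase v) * PiV (V.erase v) * PiV (V.erase v)
    + (2 : MvPolynomial α ℤ) * E1V (V.erase v) * PiV (V.erase v) * PiV (V.erase v) * hYV (V.erase v) KX KZ
    + E1V (V.erase v) * PiV (V.erase v) * PiV (V.erase v) * hY0L (V.erase v) KX KZ v
    + E1V (V.erase v) * PiV (V.erase v) * D0V (V.erase v)
    - E1V (V.erase v) * PiV (V.erase v) * hV (V.erase v) KZ
    - E1V (V.erase v) * PiV (V.erase v) * h0L (V.erase v) KZ v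
    + E1V (V.erase v) * PiV (V.erase v) * fV (V.erase v) KX * tV (V.erase v) KZ
    + E1V (V.erase v) * PiV (V.erase v) * fV (V.erase v) KX * t0L (V.erase v) KZ v
    + E1V (V.erase v) * PiV (V.erase v) * cL (V.erase v) KX v * tV (V.erase v) KZ
    - E1V (V.erase v) * PiV (V.erase v) * cV (V.erase v) KX * cV (V.erase v) KZ
    - E1V (V.erase v) * D0V (V.erase v) * cL (V.erase v) KX v * cV (V.erase v) KZ
    - E1V (V.erase v) * D0V (V.erase v) * cV (V.erase v) KX * cL (V.erase v) KZ v
    + PiV (V.erase v) * PiV (V.erase v) * hYV (V.erase v) KX KZ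
    - PiV (V.erase v) * PiV (V.erase v) * eYV (V.erase v) KX KZ
    + PiV (V.erase v) * D0V (V.erase v)
    - PiV (V.erase v) * D0V (V.erase v) * hY0L (V.erase v) KX KZ v
    - PiV (V.erase v) * D0V (V.erase v) * eYV (V.erase v) KX KZ
    - PiV (V.erase v) * hV (V.erase v) KZ
    + PiV (V.erase v) * fV (V.erase v) KX * tV (V.erase v) KZ
    - D0V (V.erase v) * cV (V.erase v) KX * cV (V.erase v) KZ

/-- The coefficient of `r_v^2` in the vertex expansion of `PARA1` (object form, generated). [this work] -/
noncomputable def PARA1N2 (V : Finset α) (KX KZ : Finset (Finset α)) (v : α) : MvPolynomial α ℤ :=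
  E1V (V.erase v) * PiV (V.erase v) * PiV (V.erase v)
    + E1V (V.erase v) * PiV (V.erase v) * PiV (V.erase v) * hYV (V.erase v) KX KZ
    + (2 : MvPolynomial α ℤ) * E1V (V.erase v) * PiV (V.erase v) * PiV (V.erase v) * hY0L (V.erase v) KX KZ v
    - E1V (V.erase v) * PiV (V.erase v) * h0L (V.erase v) KZ v
    + E1V (V.erase v) * PiV (V.erase v) * fV (V.erase v) KX * t0L (V.erase v) KZ v
    + E1V (V.erase v) * PiV (V.erase v) * cL (V.erase v) KX v * tV (V.erase v) KZ
    + E1V (V.erase v) * PiV (V.erase v) * cL (V.erase v) KX v * t0L (V.erase v) KZ v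
    - E1V (V.erase v) * PiV (V.erase v) * cL (V.erase v) KX v * cV (V.erase v) KZ
    - E1V (V.erase v) * PiV (V.erase v) * cV (V.erase v) KX * cL (V.erase v) KZ v
    - E1V (V.erase v) * D0V (V.erase v) * cL (V.erase v) KX v * cL (V.erase v) KZ v
    + PiV (V.erase v) * PiV (V.erase v)
    + (2 : MvPolynomial α ℤ) * PiV (V.erase v) * PiV (V.erase v) * hYV (V.erase v) KX KZ
    - PiV (V.erase v) * PiV (V.erase v) * eYV (V.erase v) KX KZ
    + PiV (V.erase v) * D0V (V.erase v)
    - PiV (V.erase v) * D0V (V.erase v) * hY0L (V.erase v) KX KZ v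
    - PiV (V.erase v) * hV (V.erase v) KZ
    - PiV (V.erase v) * h0L (V.erase v) KZ v
    + PiV (V.erase v) * fV (V.erase v) KX * tV (V.erase v) KZ
    + PiV (V.erase v) * fV (V.erase v) KX * t0L (V.erase v) KZ v
    + PiV (V.erase v) * cL (V.erase v) KX v * tV (V.erase v) KZ
    - PiV (V.erase v) * cV (V.erase v) KX * cV (V.erase v) KZ
    - D0V (V.erase v) * cL (V.erase v) KX v * cV (V.erase v) KZ
    - D0V (V.erase v) * cV (V.erase v) KX * cL (V.erase v) KZ v

/-- The coefficient of `r_v^3` in the vertex expansion of `PARA1` (object form, generated). [this work] -/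
noncomputable def PARA1N3 (V : Finset α) (KX KZ : Finset (Finset α)) (v : α) : MvPolynomial α ℤ :=
  E1V (V.erase v) * PiV (V.erase v) * PiV (V.erase v) * hY0L (V.erase v) KX KZ v
    + E1V (V.erase v) * PiV (V.erase v) * cL (V.erase v) KX v * t0L (V.erase v) KZ v
    - E1V (V.erase v) * PiV (V.erase v) * cL (V.erase v) KX v * cL (V.erase v) KZ v
    + PiV (V.erase v) * PiV (V.erase v)
    + PiV (V.erase v) * PiV (V.erase v) * hYV (V.erase v) KX KZ
    + PiV (V.erase v) * PiV (V.erase v) * hY0L (V.erase v) KX KZ v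
    - PiV (V.erase v) * h0L (V.erase v) KZ v
    + PiV (V.erase v) * fV (V.erase v) KX * t0L (V.erase v) KZ v
    + PiV (V.erase v) * cL (V.erase v) KX v * tV (V.erase v) KZ
    + PiV (V.erase v) * cL (V.erase v) KX v * t0L (V.erase v) KZ v
    - PiV (V.erase v) * cL (V.erase v) KX v * cV (V.erase v) KZ
    - PiV (V.erase v) * cV (V.erase v) KX * cL (V.erase v) KZ v
    - D0V (V.erase v) * cL (V.erase v) KX v * cL (V.erase v) KZ v

/-- The coefficient of `r_v^4` in the vertex expansion of `PARA1` (object form, generated). [this work] -/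
noncomputable def PARA1N4 (V : Finset α) (KX KZ : Finset (Finset α)) (v : α) : MvPolynomial α ℤ :=
  PiV (V.erase v) * PiV (V.erase v) * hY0L (V.erase v) KX KZ v
    + PiV (V.erase v) * cL (V.erase v) KX v * t0L (V.erase v) KZ v
    - PiV (V.erase v) * cL (V.erase v) KX v * cL (V.erase v) KZ v


end objects

/-! ### The vertex expansion of `PARA₁` -/

section expansion
variable {V : Finset α} {v : α} (K KX KZ : Finset (Finset α))

/-- **Vertex expansion** `PARA1_V = PARA1_{V−v} + r_v·N₁ + r_v²·N₂ + r_v³·N₃ + r_v⁴·N₄`. [this work] -/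
theorem PARA1V_expand (hv : v ∈ V) :
    PARA1V V KX KZ = PARA1V (V.erase v) KX KZ + X v * PARA1N1 V KX KZ v + X v ^ 2 * PARA1N2 V KX KZ v
      + X v ^ 3 * PARA1N3 V KX KZ v + X v ^ 4 * PARA1N4 V KX KZ v := by
  have l0 : ((V.erase v).powerset.filter fun S => 1 ≤ #(insert v S)) = (V.erase v).powerset :=
    filter_true_of_mem fun S hS => by rw [card_insert_of_notMem (subset_erase.1 (mem_powerset.1 hS)).2]; omega
  have l1 : ((V.erase v).powerset.filter fun S => #(insert v S) = 1) = (V.erase v).powerset.filter fun S => #S = 0 :=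
    link_filter_congr V v fun S hS => by rw [card_insert_of_notMem hS]; exact ⟨fun h => by omega, fun h => by omega⟩
  have l3 : ∀ K : Finset (Finset α), ((V.erase v).powerset.filter fun S => #(insert v S) ≤ 1 ∧ insert v S ∈ K) =
      (V.erase v).powerset.filter fun S => #S = 0 ∧ insert v S ∈ K := fun K =>
    link_filter_congr V v fun S hS => by rw [card_insert_of_notMem hS]; exact and_congr ⟨fun h => by omega, fun h => by omega⟩ Iff.rfl
  have l4 : ∀ K : Finset (Finset α), ((V.erase v).powerset.filter fun S => 2 ≤ #(insert v S) ∧ insert v S ∈ K) =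
      (V.erase v).powerset.filter fun S => 1 ≤ #S ∧ insert v S ∈ K := fun K =>
    link_filter_congr V v fun S hS => by rw [card_insert_of_notMem hS]; exact and_congr ⟨fun h => by omega, fun h => by omega⟩ Iff.rfl
  have l4' : ∀ K : Finset (Finset α), ((V.erase v).powerset.filter fun S => 1 ≤ #(insert v S) ∧ insert v S ∈ K) =
      (V.erase v).powerset.filter fun S => insert v S ∈ K := fun K =>
    link_filter_congr V v fun S hS => by rw [card_insert_of_notMem hS]; exact ⟨fun h => h.2, fun h => ⟨by omega, h⟩⟩
  have l5 : ((V.erase v).powerset.filter fun S => #(insert v S) ≤ 1 ∧ insert v S ∈ KX ∧ insert v S ∈ KZ) =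
      (V.erase v).powerset.filter fun S => #S = 0 ∧ insert v S ∈ KX ∧ insert v S ∈ KZ :=
    link_filter_congr V v fun S hS => by rw [card_insert_of_notMem hS]; exact and_congr ⟨fun h => by omega, fun h => by omega⟩ Iff.rfl
  have l6 : ((V.erase v).powerset.filter fun S => #(insert v S) = 1 ∧ insert v S ∈ KX ∧ insert v S ∈ KZ) =
      (V.erase v).powerset.filter fun S => #S = 0 ∧ insert v S ∈ KX ∧ insert v S ∈ KZ :=
    link_filter_congr V v fun S hS => by rw [card_insert_of_notMem hS]; exact and_congr ⟨fun h => by omega, fun h => by omega⟩ Iff.rfl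
  have l7 : gf ((V.erase v).powerset.filter fun S => #S = 0) = (1 : MvPolynomial α ℤ) := by
    have : ((V.erase v).powerset.filter fun S => #S = 0) = {∅} := by
      ext S; simp only [mem_filter, mem_powerset, card_eq_zero, mem_singleton]
      exact ⟨fun h => h.2, fun h => ⟨h ▸ empty_subset _, h⟩⟩
    rw [this]; unfold gf; rw [sum_singleton]; unfold ind; rw [sum_empty]; rfl
  unfold PARA1V PARA1N1 PARA1N2 PARA1N3 PARA1N4 PiV D0V E1V hV tV fV cV hYV eYV h0L t0L hY0L cL
  rw [gf_powerset_split hv, gf_powerset_filter_split hv (fun S => #S = 1), gf_powerset_filter_split hv (fun S => 1 ≤ #S),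
    gf_powerset_filter_split hv (fun S => #S ≤ 1 ∧ S ∈ KZ), gf_powerset_filter_split hv (fun S => 2 ≤ #S ∧ S ∈ KZ),
    gf_powerset_filter_split hv (fun S => 1 ≤ #S ∧ S ∈ KX), gf_powerset_filter_split hv (fun S => S ∈ KX), gf_powerset_filter_split hv (fun S => S ∈ KZ),
    gf_powerset_filter_split hv (fun S => #S ≤ 1 ∧ S ∈ KX ∧ S ∈ KZ), gf_powerset_filter_split hv (fun S => #S = 1 ∧ S ∈ KX ∧ S ∈ KZ)]
  simp only [l0, l1, l3, l4, l4', l5, l6, l7]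
  ring

/-- Base of the induction: on the empty ground set `PARA₁ = 0`. [this work] -/
theorem PARA1V_empty : PARA1V (∅ : Finset α) KX KZ = 0 := by
  unfold PARA1V E1V D0V
  have gf0 : gf (∅ : Finset (Finset α)) = 0 := by unfold gf; rw [sum_empty]
  simp only [powerset_empty, filter_singleton, card_empty]
  norm_num [gf0]

end expansion

/-! ### Dictionary entries for the new objects -/

section dictionary
variable {V' : Finset α} {KX KZ : Finset (Finset α)} {v : α}

/-- Dictionary: `e₁`. [this work] -/
theorem dict_e1 : (V'.powerset.filter fun S => #S = 1) = statFam V' KX KZ v (fun _ _ L => L = 1) :=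
  filter_eq_statFam _ _ fun S _ => by rw [lvl_eq_one_iff]
/-- Dictionary: `f_X` (nonempty faces of `K_X`). [this work] -/
theorem dict_fX (hKX : IsLowerSet (KX : Set (Finset α))) :
    (V'.powerset.filter fun S => 1 ≤ #S ∧ S ∈ KX) = statFam V' KX KZ v (fun a _ L => 1 ≤ L ∧ a ≤ 1) :=
  filter_eq_statFam _ _ fun S _ => by rw [one_le_lvl_iff, stat_le_one_iff hKX]
/-- Dictionary: `f_Z`. [this work] -/
theorem dict_fZ (hKZ : IsLowerSet (KZ : Set (Finset α))) :
    (V'.powerset.filter fun S => 1 ≤ #S ∧ S ∈ KZ) = statFam V' KX KZ v (fun _ b L => 1 ≤ L ∧ b ≤ 1) :=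
  filter_eq_statFam _ _ fun S _ => by rw [one_le_lvl_iff, stat_le_one_iff hKZ]
/-- Dictionary: `c_X = |K_X|`. [this work] -/
theorem dict_cX (hKX : IsLowerSet (KX : Set (Finset α))) :
    (V'.powerset.filter fun S => S ∈ KX) = statFam V' KX KZ v (fun a _ _ => a ≤ 1) :=
  filter_eq_statFam _ _ fun S _ => by rw [stat_le_one_iff hKX]
/-- Dictionary: `c_Z = |K_Z|`. [this work] -/
theorem dict_cZ (hKZ : IsLowerSet (KZ : Set (Finset α))) :
    (V'.powerset.filter fun S => S ∈ KZ) = statFam V' KX KZ v (fun _ b _ => b ≤ 1) :=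
  filter_eq_statFam _ _ fun S _ => by rw [stat_le_one_iff hKZ]
/-- Dictionary: the link of `c_X` at `v`. [this work] -/
theorem dict_cLX : (V'.powerset.filter fun S => insert v S ∈ KX) = statFam V' KX KZ v (fun a _ _ => a = 0) :=
  filter_eq_statFam _ _ fun S _ => by rw [stat_eq_zero_iff]
/-- Dictionary: the link of `c_Z` at `v`. [this work] -/
theorem dict_cLZ : (V'.powerset.filter fun S => insert v S ∈ KZ) = statFam V' KX KZ v (fun _ b _ => b = 0) :=
  filter_eq_statFam _ _ fun S _ => by rw [stat_eq_zero_iff]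

end dictionary



section expansions
variable (V' : Finset α) (KX KZ : Finset (Finset α)) (v : α)

/-- Atom expansion of a status family (generated). [this work] -/
theorem gf_statFam_obj_dd_X_0BCD : gf (statFam V' KX KZ v (fun a _ _ => a ≤ 1)) =
    atom V' KX KZ v 0 0 0 + atom V' KX KZ v 0 0 1 + atom V' KX KZ v 0 0 2 + atom V' KX KZ v 0 0 3 + atom V' KX KZ v 0 1 0 + atom V' KX KZ v 0 1 1 + atom V' KX KZ v 0 1 2 + atom V' KX KZ v 0 1 3 + atom V' KX KZ v 0 2 0 + atom V' KX KZ v 0 2 1 + atom V' KX KZ v 0 2 2 + atom V' KX KZ v 0 2 3 + atom V' KX KZ v 1 0 0 + atom V' KX KZ v 1 0 1 + atom V' KX KZ v 1 0 2 + atom V' KX KZ v 1 0 3 + atom V' KX KZ v 1 1 0 + atom V' KX KZ v 1 1 1 + atom V' KX KZ v 1 1 2 + atom V' KX KZ v 1 1 3 + atom V' KX KZ v 1 2 0 + atom V' KX KZ v 1 2 1 + atom V' KX KZ v 1 2 2 + atom V' KX KZ v 1 2 3 := by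
  rw [gf_statFam]; simp only [Finset.sum_range_succ, Finset.sum_range_zero]; norm_num [add_assoc]

/-- Atom expansion of a status family (generated). [this work] -/
theorem gf_statFam_obj_dd_X_BCD : gf (statFam V' KX KZ v (fun a _ L => 1 ≤ L ∧ a ≤ 1)) =
    atom V' KX KZ v 0 0 1 + atom V' KX KZ v 0 0 2 + atom V' KX KZ v 0 0 3 + atom V' KX KZ v 0 1 1 + atom V' KX KZ v 0 1 2 + atom V' KX KZ v 0 1 3 + atom V' KX KZ v 0 2 1 + atom V' KX KZ v 0 2 2 + atom V' KX KZ v 0 2 3 + atom V' KX KZ v 1 0 1 + atom V' KX KZ v 1 0 2 + atom V' KX KZ v 1 0 3 + atom V' KX KZ v 1 1 1 + atom V' KX KZ v 1 1 2 + atom V' KX KZ v 1 1 3 + atom V' KX KZ v 1 2 1 + atom V' KX KZ v 1 2 2 + atom V' KX KZ v 1 2 3 := by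
  rw [gf_statFam]; simp only [Finset.sum_range_succ, Finset.sum_range_zero]; norm_num [add_assoc]

/-- Atom expansion of a status family (generated). [this work] -/
theorem gf_statFam_obj_dd_Z_0BCD : gf (statFam V' KX KZ v (fun _ b _ => b ≤ 1)) =
    atom V' KX KZ v 0 0 0 + atom V' KX KZ v 0 0 1 + atom V' KX KZ v 0 0 2 + atom V' KX KZ v 0 0 3 + atom V' KX KZ v 0 1 0 + atom V' KX KZ v 0 1 1 + atom V' KX KZ v 0 1 2 + atom V' KX KZ v 0 1 3 + atom V' KX KZ v 1 0 0 + atom V' KX KZ v 1 0 1 + atom V' KX KZ v 1 0 2 + atom V' KX KZ v 1 0 3 + atom V' KX KZ v 1 1 0 + atom V' KX KZ v 1 1 1 + atom V' KX KZ v 1 1 2 + atom V' KX KZ v 1 1 3 + atom V' KX KZ v 2 0 0 + atom V' KX KZ v 2 0 1 + atom V' KX KZ v 2 0 2 + atom V' KX KZ v 2 0 3 + atom V' KX KZ v 2 1 0 + atom V' KX KZ v 2 1 1 + atom V' KX KZ v 2 1 2 + atom V' KX KZ v 2 1 3 := by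
  rw [gf_statFam]; simp only [Finset.sum_range_succ, Finset.sum_range_zero]; norm_num [add_assoc]

/-- Atom expansion of a status family (generated). [this work] -/
theorem gf_statFam_obj_ll_X_0BCD : gf (statFam V' KX KZ v (fun a _ _ => a = 0)) =
    atom V' KX KZ v 0 0 0 + atom V' KX KZ v 0 0 1 + atom V' KX KZ v 0 0 2 + atom V' KX KZ v 0 0 3 + atom V' KX KZ v 0 1 0 + atom V' KX KZ v 0 1 1 + atom V' KX KZ v 0 1 2 + atom V' KX KZ v 0 1 3 + atom V' KX KZ v 0 2 0 + atom V' KX KZ v 0 2 1 + atom V' KX KZ v 0 2 2 + atom V' KX KZ v 0 2 3 := by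
  rw [gf_statFam]; simp only [Finset.sum_range_succ, Finset.sum_range_zero]; norm_num [add_assoc]

/-- Atom expansion of a status family (generated). [this work] -/
theorem gf_statFam_obj_ll_Z_0BCD : gf (statFam V' KX KZ v (fun _ b _ => b = 0)) =
    atom V' KX KZ v 0 0 0 + atom V' KX KZ v 0 0 1 + atom V' KX KZ v 0 0 2 + atom V' KX KZ v 0 0 3 + atom V' KX KZ v 1 0 0 + atom V' KX KZ v 1 0 1 + atom V' KX KZ v 1 0 2 + atom V' KX KZ v 1 0 3 + atom V' KX KZ v 2 0 0 + atom V' KX KZ v 2 0 1 + atom V' KX KZ v 2 0 2 + atom V' KX KZ v 2 0 3 := by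
  rw [gf_statFam]; simp only [Finset.sum_range_succ, Finset.sum_range_zero]; norm_num [add_assoc]

/-- Atom expansion of a status family (generated). [this work] -/
theorem gf_statFam_dr123_dr221 : gf (statFam V' KX KZ v (fun a b L => (a ≤ 1 ∧ b ≤ 2 ∧ L ≤ 3) ∧ (a ≤ 2 ∧ b ≤ 2 ∧ L ≤ 1))) =
    atom V' KX KZ v 0 0 0 + atom V' KX KZ v 0 0 1 + atom V' KX KZ v 0 1 0 + atom V' KX KZ v 0 1 1 + atom V' KX KZ v 0 2 0 + atom V' KX KZ v 0 2 1 + atom V' KX KZ v 1 0 0 + atom V' KX KZ v 1 0 1 + atom V' KX KZ v 1 1 0 + atom V' KX KZ v 1 1 1 + atom V' KX KZ v 1 2 0 + atom V' KX KZ v 1 2 1 := by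
  rw [gf_statFam]; simp only [Finset.sum_range_succ, Finset.sum_range_zero]; norm_num [add_assoc]

/-- Atom expansion of a status family (generated). [this work] -/
theorem gf_statFam_dXC : gf (statFam V' KX KZ v (fun a _ L => a ≤ 1 ∧ L = 2)) =
    atom V' KX KZ v 0 0 2 + atom V' KX KZ v 0 1 2 + atom V' KX KZ v 0 2 2 + atom V' KX KZ v 1 0 2 + atom V' KX KZ v 1 1 2 + atom V' KX KZ v 1 2 2 := by
  rw [gf_statFam]; simp only [Finset.sum_range_succ, Finset.sum_range_zero]; norm_num [add_assoc]

/-- Atom expansion of a status family (generated). [this work] -/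
theorem gf_statFam_dXD : gf (statFam V' KX KZ v (fun a _ L => a ≤ 1 ∧ L = 3)) =
    atom V' KX KZ v 0 0 3 + atom V' KX KZ v 0 1 3 + atom V' KX KZ v 0 2 3 + atom V' KX KZ v 1 0 3 + atom V' KX KZ v 1 1 3 + atom V' KX KZ v 1 2 3 := by
  rw [gf_statFam]; simp only [Finset.sum_range_succ, Finset.sum_range_zero]; norm_num [add_assoc]

/-- Atom expansion of a status family (generated). [this work] -/
theorem gf_statFam_dZB : gf (statFam V' KX KZ v (fun _ b L => b ≤ 1 ∧ L = 1)) =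
    atom V' KX KZ v 0 0 1 + atom V' KX KZ v 0 1 1 + atom V' KX KZ v 1 0 1 + atom V' KX KZ v 1 1 1 + atom V' KX KZ v 2 0 1 + atom V' KX KZ v 2 1 1 := by
  rw [gf_statFam]; simp only [Finset.sum_range_succ, Finset.sum_range_zero]; norm_num [add_assoc]

/-- Atom expansion of a status family (generated). [this work] -/
theorem gf_statFam_dr113eq1 : gf (statFam V' KX KZ v (fun a b L => (a ≤ 1 ∧ b ≤ 1 ∧ L ≤ 3) ∧ L = 1)) =
    atom V' KX KZ v 0 0 1 + atom V' KX KZ v 0 1 1 + atom V' KX KZ v 1 0 1 + atom V' KX KZ v 1 1 1 := by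
  rw [gf_statFam]; simp only [Finset.sum_range_succ, Finset.sum_range_zero]; norm_num [add_assoc]

/-- Atom expansion of a status family (generated). [this work] -/
theorem gf_statFam_dr113eq2 : gf (statFam V' KX KZ v (fun a b L => (a ≤ 1 ∧ b ≤ 1 ∧ L ≤ 3) ∧ L = 2)) =
    atom V' KX KZ v 0 0 2 + atom V' KX KZ v 0 1 2 + atom V' KX KZ v 1 0 2 + atom V' KX KZ v 1 1 2 := by
  rw [gf_statFam]; simp only [Finset.sum_range_succ, Finset.sum_range_zero]; norm_num [add_assoc]

/-- Atom expansion of a status family (generated). [this work] -/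
theorem gf_statFam_dr113eq3 : gf (statFam V' KX KZ v (fun a b L => (a ≤ 1 ∧ b ≤ 1 ∧ L ≤ 3) ∧ L = 3)) =
    atom V' KX KZ v 0 0 3 + atom V' KX KZ v 0 1 3 + atom V' KX KZ v 1 0 3 + atom V' KX KZ v 1 1 3 := by
  rw [gf_statFam]; simp only [Finset.sum_range_succ, Finset.sum_range_zero]; norm_num [add_assoc]

/-- Atom expansion of a status family (generated). [this work] -/
theorem gf_statFam_lZC : gf (statFam V' KX KZ v (fun _ b L => b = 0 ∧ L = 2)) =
    atom V' KX KZ v 0 0 2 + atom V' KX KZ v 1 0 2 + atom V' KX KZ v 2 0 2 := by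
  rw [gf_statFam]; simp only [Finset.sum_range_succ, Finset.sum_range_zero]; norm_num [add_assoc]

/-- Atom expansion of a status family (generated). [this work] -/
theorem gf_statFam_dr103eq1 : gf (statFam V' KX KZ v (fun a b L => (a ≤ 1 ∧ b ≤ 0 ∧ L ≤ 3) ∧ L = 1)) =
    atom V' KX KZ v 0 0 1 + atom V' KX KZ v 1 0 1 := by
  rw [gf_statFam]; simp only [Finset.sum_range_succ, Finset.sum_range_zero]; norm_num [add_assoc]

/-- Atom expansion of a status family (generated). [this work] -/
theorem gf_statFam_dr103ge2 : gf (statFam V' KX KZ v (fun a b L => (a ≤ 1 ∧ b ≤ 0 ∧ L ≤ 3) ∧ 2 ≤ L)) =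
    atom V' KX KZ v 0 0 2 + atom V' KX KZ v 0 0 3 + atom V' KX KZ v 1 0 2 + atom V' KX KZ v 1 0 3 := by
  rw [gf_statFam]; simp only [Finset.sum_range_succ, Finset.sum_range_zero]; norm_num [add_assoc]

/-- Atom expansion of a status family (generated). [this work] -/
theorem gf_statFam_dr103eq3 : gf (statFam V' KX KZ v (fun a b L => (a ≤ 1 ∧ b ≤ 0 ∧ L ≤ 3) ∧ L = 3)) =
    atom V' KX KZ v 0 0 3 + atom V' KX KZ v 1 0 3 := by
  rw [gf_statFam]; simp only [Finset.sum_range_succ, Finset.sum_range_zero]; norm_num [add_assoc]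

/-- Atom expansion of a status family (generated). [this work] -/
theorem gf_statFam_dr023lo1 : gf (statFam V' KX KZ v (fun a b L => (a ≤ 0 ∧ b ≤ 2 ∧ L ≤ 3) ∧ (1 ≤ L ∧ L ≤ 1))) =
    atom V' KX KZ v 0 0 1 + atom V' KX KZ v 0 1 1 + atom V' KX KZ v 0 2 1 := by
  rw [gf_statFam]; simp only [Finset.sum_range_succ, Finset.sum_range_zero]; norm_num [add_assoc]

/-- Atom expansion of a status family (generated). [this work] -/
theorem gf_statFam_dr023ge2 : gf (statFam V' KX KZ v (fun a b L => (a ≤ 0 ∧ b ≤ 2 ∧ L ≤ 3) ∧ 2 ≤ L)) =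
    atom V' KX KZ v 0 0 2 + atom V' KX KZ v 0 0 3 + atom V' KX KZ v 0 1 2 + atom V' KX KZ v 0 1 3 + atom V' KX KZ v 0 2 2 + atom V' KX KZ v 0 2 3 := by
  rw [gf_statFam]; simp only [Finset.sum_range_succ, Finset.sum_range_zero]; norm_num [add_assoc]

/-- Atom expansion of a status family (generated). [this work] -/
theorem gf_statFam_lXD : gf (statFam V' KX KZ v (fun a _ L => a = 0 ∧ L = 3)) =
    atom V' KX KZ v 0 0 3 + atom V' KX KZ v 0 1 3 + atom V' KX KZ v 0 2 3 := by
  rw [gf_statFam]; simp only [Finset.sum_range_succ, Finset.sum_range_zero]; norm_num [add_assoc]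

end expansions

end Summit.CriticalPhenomena.PercolationContinuityZ3.Theorems.SahiCTCForms
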